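import Mathlib
import Literature.MathematicalPhysics.KineticTheory.HarmonicHostWithCell

/-!
# The cell transfer operator: spectral-temperature scattering data of one cell in the harmonic host

Topic `Literature/MathematicalPhysics/KineticTheory`, grouping namespace `…KineticTheory.HeatConduction`
(as `HarmonicHostWithCell.lean`, whose `hostDispersion`, `harmonicHostWithCell`, `InfiniteChain.Dynamics`
and `IsSmoothLocalObservable` are used). Definition request `defn-cellTransferOperator` (route
`AtomisticToContinuum/FouriersLaw/Theses/GaussianiserCellTransfer`, item CellTransferGap
`stmt-AtomisticToContinuum-5557`): the POSITED object `𝒦_T` of that item as an INTERFACE (a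
hypothesis structure: data + axioms, no existence asserted), plus the vocabulary needed to state
(a) the gap / irreducibility claims about it and (b) the separate CONSTRUCTION statement linking it
to the dynamics of one conjunct cell in the infinite pinned harmonic host.

## Physical picture (what the fields mean)

The infinite pinned harmonic host (`harmonicHostWithCell ω₂ lam β ∅`, dispersion
`ω(k) = √(ω₂ + 2 - 2 cos k)`, `hostDispersion`) carries phonons of wavenumber `k` in the band
`(-π, π)` (`hostBand`; `k = ±π` identified, a null set) with group velocity
`v(k) = ω'(k) = sin k / ω(k)` (`hostGroupVelocity`, `hasDerivAt_hostDispersion`): `k ∈ (0, π)` moves to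
the right, `k ∈ (-π, 0)` to the left, `v(-k) = -v(k)`, `|v| ≤ 1`. A stationary translation-invariant
(Gaussian) state of the host is described by its SPECTRAL TEMPERATURE PROFILE `ϑ(k) ≥ 0`, the energy
per mode: `⟨p_m p_n⟩ = (2π)⁻¹ ∫ ϑ(k) cos(k(m-n)) dk`, `⟨q_m q_n⟩ = (2π)⁻¹ ∫ ϑ(k) cos(k(m-n))/ω(k)² dk`,
`⟨q_m p_n⟩ = -(2π)⁻¹ ∫ ϑ(k) sin(k(m-n))/ω(k) dk` (`profileCovPP/QQ/QP`; for a single wave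
`q_x = A cos(kx - ωt + φ)` these are `e cos(k(m-n))`, `e cos(k(m-n))/ω²`, `-(e/ω) sin(k(m-n))` with
`e = A²ω²/2` its energy per site); thermal equilibrium at temperature `T` is the FLAT profile `ϑ ≡ T`
(`profileCovPP_const_self`: `⟨p_m²⟩ = T`), and the mean energy current through a bond is
`(2π)⁻¹ ∫ v(k) ϑ(k) dk` (with the tree's bond current `-(p_i+p_{i+1})(q_{i+1}-q_i)/2` of
`OscillatorChain.bondCurrent` for `V = r²/2`).

Put ONE cell (the conjunct's `lam q₀⁴/4 + β (q₁-q₀)⁴/4`, `harmonicHostWithCell ω₂ lam β {0}`) into the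
host at temperature `T` and perturb the INCIDENT radiation: profile `T + ε θ(k)` where, on the whole
band, `θ` on `(0, π)` is incident FROM THE LEFT (right-movers far to the left of the cell) and `θ` on
`(-π, 0)` is incident FROM THE RIGHT. To first order in `ε` the OUTGOING radiation (right-movers far to
the right, left-movers far to the left) has profile `T + ε (𝕊_T θ)(k) + o(ε)`. The request's
`𝒦_T` ("left-incoming `T + ε θ_in`, right-incoming thermal ⇒ right-outgoing `T + ε 𝒦_T θ_in`") is the
block of `𝕊_T` from `(0, π)` to `(0, π)` (`cellTransferOperator`), and its `ℛ_T` (the reflected part,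
read back on `(0, π)` through `k ↦ -k`) is the block `(0, π) → (-π, 0)` (`cellReflectionOperator`).
Working with the whole band at once is what makes "profiles on `L²(band, dk)`, band `= [-π, π]`"
(the request) literal, keeps both incidence sides (the conjunct cell is NOT mirror symmetric: the
quartic pinning sits left of the quartic bond), and makes the equilibrium statement `𝕊_T 1 = 1`
meaningful (for the block alone `𝒦_T 1 = 1 - ℛ'_T 1 ≠ 1` as soon as the cell reflects).

## Contents

* `hostBand`, `hostBandMeasure` (Lebesgue on `(-π, π)`, finite, invariant under `k ↦ -k`:
  `measurePreserving_neg_hostBand`), `SpectralProfile := Lp ℝ 2 hostBandMeasure` (the request's `L²(band, dk)`;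
  `dk =` density of states `× dω` on each half band), `flatProfile` (`≡ 1`), `hostGroupVelocity` with
  `hasDerivAt_hostDispersion`, oddness, positivity on `(0, π)`, `|v| ≤ 1`, and the flux functional
  `bandFlux ω₂ θ = ∫ |v(k)| θ(k) dk` (power carried towards / away from the cell, `× 2π`).
* Operators on profiles: `spectralMulOp m` (multiplication by `m ∈ L^∞`, Mathlib `ContinuousLinearMap.holderL`),
  `rightMoverProj` (restriction to the right-movers `k > 0`), `spectralReflection` (`θ ↦ θ(-·)`, an isometry).
* `CellScattering ω₂` — THE INTERFACE. Fields: the bounded linear map `op = 𝕊_T` on `SpectralProfile`; the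
  elastic data `transProb k = |t_T(k)|²`, `reflProb k = |r_T(k)|²` (measurable, valued in `[0, 1]`);
  the inelastic kernel `kernel k k' = R_T(k, k') ≥ 0`, Hilbert–Schmidt (`MemLp … 2 (band × band)`);
  the DECOMPOSITION axiom `op_apply`:
  `(𝕊θ)(k) = |t(k)|² θ(k) + |r(-k)|² θ(-k) + ∫ R(k, k') θ(k') dk'` a.e.; and ENERGY CONSERVATION
  `bandFlux_op : ∫ |v| 𝕊θ = ∫ |v| θ`. POSITIVITY (`θ ≥ 0 ⇒ 𝕊θ ≥ 0`, `op_nonneg`) is then a theorem,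
  as are the request's block statements: `cellTransferOperator S = 𝒦_T`, `cellReflectionOperator S = ℛ_T`,
  their positivity, the decomposition `𝒦_T =` (multiplication by `|t_T|²`) `+` (kernel `R_T` on
  `(0,π)²`) (`cellTransferOperator_apply`), and the request's balance
  `∫_0^π v [(𝒦_T θ) + (ℛ_T θ) - θ] dk = 0` (`bandFlux_cellTransfer_add_cellReflection`).
  Non-vacuity: `CellScattering.transparent` (no cell: `t ≡ 1`, `r ≡ 0`, `R ≡ 0`, `𝕊 = id`) and, with a
  NONZERO inelastic kernel, `CellScattering.probe` — the self-consistent point scatterer (`ProbeData`: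
  `τ + ρ + g = 1`, `ρ` even): `𝕊θ = τθ + ρ(-·)θ(-·) + g Z⁻¹ ∫ |v| g θ`, rank-one kernel
  `R(k,k') = g(k) |v(k')| g(k') / Z`, energy conservation PROVED (`ProbeData.bandFlux_op`: what is
  absorbed is re-emitted) and `𝕊 1 = 1` PROVED (`CellScattering.probe_preservesFlat`).
* Statement vocabulary for CellTransferGap (a): `CellScattering.PreservesFlat` (`𝕊 1 = 1`),
  `HasFlatGap K` (flat profile fixed, strict contraction on its orthogonal complement — hence `1` is a
  geometrically simple eigenvalue, `HasFlatGap.eq_smul_flat_of_fixed`), `IsIrreducibleKernel R`, and the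
  shape `HasQuadraticKernelExpansion` of the order-`(lam², β², lam β)` (Fermi-golden-rule) expansion of
  the inelastic kernel of a two-parameter family — the explicit kernels are arguments, NOT computed here.
* SEMANTICS (for the CONSTRUCTION statement, a later support item): asymptotic profiles of a state
  `μ` on `ChainConfig` far to the right / left (`HasRightProfile`, `HasLeftProfile`: limits of the
  `q/p` covariances in shifted windows `=` the spectral covariances of `ϑ`; cross terms between `k` and
  `-k` average out far from the cell by Riemann–Lebesgue, so window limits ARE translation invariant),
  exact profile states (`IsProfileState`), the INCOMING STATE of a stationary `μ` as the local weak limit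
  of its FREE evolution (`Dynamics.IsIncomingStateOf`: for `Φ`-invariant `μ`,
  `(Φ⁰_t ∘ Φ_{-t})_* μ = (Φ⁰_t)_* μ`, so no wave operator on paths is needed), the linear-response
  predicate `IsCellScatteringOf D₀ D T S` (every stationary `L²` state whose incoming state is the
  Gaussian profile state `T + εθ` has outgoing profile `T + ε 𝕊θ + o(ε)` in `L²(band)`, for bounded `θ`),
  and the construction statement shape `HasGaussianScatteringStates D₀ D T` (existence and uniqueness of
  these stationary states for small `ε`). Both take the free host dynamics `D₀` and the cell dynamics `D`
  as data (`InfiniteChain.Dynamics`, as everywhere in this layer).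

## Sources and nearest calculus

The transmission / reflection / absorption probabilities of a phonon of wavenumber `k` at a point
scatterer in the harmonic chain, as multiplication operators on the energy density with
`p₊(k) + p₋(k) + g(k) = 1`, positivity, and the flux bookkeeping at the interface are those of the point
Langevin thermostat (Komorowski–Olla 2020: interface conditions of §1, coefficients `p₊, p₋, 𝔤` of §2.6,
kinetic limit Thm 2.9; review Komorowski–Olla 2021); there the scatterer is linear and at fixed temperature, so the response is purely
elastic (`R = 0`) and energy is NOT conserved (`g > 0` absorbed) — re-emitting the absorbed power at a
self-consistent temperature (Bonetto–Lebowitz–Lukkarinen 2004, self-consistent reservoirs; Büttiker 1986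
probes) restores conservation with a rank-one inelastic kernel `∝ g(k) g(k') |v(k')|`. Energy density /
current of lattice waves resolved in wavenumber (`∫ ω'(k) W(k) dk`) is standard phonon kinetic theory
(Spohn 2006, §3; Lukkarinen 2016, §4; Dhar 2008, §3). For an ANHARMONIC cell nothing of this is in print:
the object is posited by the route, which is why it is an interface with a separate construction
statement and no named fact is minted (D-0026).

## Design notes, junk values

* Profiles are real `L²` classes on `ℝ` for the restricted Lebesgue measure of `(-π, π)`; values of a
  representative outside the band are irrelevant. `transProb/reflProb/kernel` are genuine functions
  (so that explicit formulas can be substituted) constrained only through `op_apply` (a.e.).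
* `|t|², |r|² ≤ 1` are recorded as fields (they follow a.e. from conservation + positivity anyway, and
  make the elastic part manifestly bounded); `𝕊 1 = 1` is NOT a field (it is the statement that the
  Gibbs state at `T + ε` is THE stationary state with flat incoming data — part of the construction /
  uniqueness statement), see `PreservesFlat`.
* `HasFlatGap` is stated for an arbitrary bounded operator on `SpectralProfile` in the UNWEIGHTED `L²(dk)` the
  request asks for; with `𝕊 ≥ 0`, `𝕊1 = 1`, `𝕊†|v| = |v|` the natural contraction space is
  `L²(|v| dk)` (`=` two copies of `L²(dω)` over the frequency band) — the statement item chooses.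
* `IsCellScatteringOf` is vacuous for an `S` unless stationary states with the prescribed Gaussian
  incoming data exist; pair it with `HasGaussianScatteringStates` (or an `∃!`) in statements.
* Junk: Bochner integrals are `0` when divergent; `cov` is Mathlib's (junk `0`); `D₀.flow` is
  unconstrained off its carrier, so `D₀` should be chosen with a carrier containing the support of the
  states considered (tempered configurations).
-/

noncomputable section

open MeasureTheory ProbabilityTheory Filter Set
open scoped ENNReal Topology InnerProductSpace

namespace Literature.MathematicalPhysics.KineticTheory.HeatConduction

/-! ## The band, its measure, profiles -/

/-- The band of wavenumbers of the host, `(-π, π)` (the endpoints `±π` describe the same mode and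
form a null set). [folklore] -/
def hostBand : Set ℝ := Ioo (-Real.pi) Real.pi

/-- Lebesgue measure `dk` on the band. [folklore] -/
def hostBandMeasure : Measure ℝ := volume.restrict hostBand

/-- The band is measurable. [folklore] -/
theorem measurableSet_hostBand : MeasurableSet hostBand := measurableSet_Ioo

/-- The band has length `2π`. [folklore] -/
theorem volume_hostBand : volume hostBand = ENNReal.ofReal (2 * Real.pi) := by
  rw [hostBand, Real.volume_Ioo, show Real.pi - -Real.pi = 2 * Real.pi by ring]

/-- The band measure is finite. [folklore] -/
instance instIsFiniteMeasureHostBandMeasure : IsFiniteMeasure hostBandMeasure := by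
  unfold hostBandMeasure hostBand; infer_instance

/-- Total mass of the band measure. [folklore] -/
theorem hostBandMeasure_univ : hostBandMeasure univ = ENNReal.ofReal (2 * Real.pi) := by
  rw [hostBandMeasure, Measure.restrict_apply_univ, volume_hostBand]

/-- The band is symmetric under `k ↦ -k`. [folklore] -/
theorem neg_preimage_hostBand : Neg.neg ⁻¹' hostBand = hostBand := by
  ext k
  simp only [hostBand, mem_preimage, mem_Ioo]
  constructor <;> rintro ⟨h1, h2⟩ <;> constructor <;> linarith

/-- `k ↦ -k` preserves the band measure. [folklore] -/
theorem measurePreserving_neg_hostBand : MeasurePreserving (Neg.neg : ℝ → ℝ) hostBandMeasure hostBandMeasure := by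
  have h := (Measure.measurePreserving_neg (volume : Measure ℝ)).restrict_preimage
    (f := (Neg.neg : ℝ → ℝ)) measurableSet_hostBand
  rwa [neg_preimage_hostBand] at h

/-- Almost every point of the band is nonzero. [folklore] -/
theorem ae_ne_zero_hostBandMeasure : ∀ᵐ k ∂hostBandMeasure, k ≠ 0 := by
  have h : ∀ᵐ k ∂(volume : Measure ℝ), k ≠ 0 := by
    simp only [ae_iff, not_not, setOf_eq_eq_singleton, measure_singleton]
  exact h.filter_mono (ae_mono Measure.restrict_le_self)

/-- Almost every point of the band measure lies in the band. [folklore] -/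
theorem ae_mem_hostBand : ∀ᵐ k ∂hostBandMeasure, k ∈ hostBand :=
  ae_restrict_mem measurableSet_hostBand

/-- **Spectral temperature profiles**: the request's `L²(band, dk)` (real-valued; `dk` is the
density of states times `dω` on each half band). On the whole band a profile describes BOTH
propagation directions: `k ∈ (0, π)` right-movers, `k ∈ (-π, 0)` left-movers. [folklore] -/
abbrev SpectralProfile : Type := Lp ℝ 2 hostBandMeasure

/-- The flat profile `θ ≡ 1` (thermal equilibrium, per unit temperature). [folklore] -/
def flatProfile : SpectralProfile := Lp.const 2 hostBandMeasure (1 : ℝ)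

/-- The flat profile is a.e. the constant `1`. [folklore] -/
theorem coeFn_flatProfile : (flatProfile : ℝ → ℝ) =ᵐ[hostBandMeasure] fun _ => 1 :=
  Lp.coeFn_const ..

/-! ## Group velocity and energy flux -/

/-- The **group velocity** of the host, `v(k) = ω'(k) = sin k / ω(k)`
(`hasDerivAt_hostDispersion`). [folklore] -/
def hostGroupVelocity (ω₂ k : ℝ) : ℝ := Real.sin k / hostDispersion ω₂ k

/-- The dispersion relation is positive for positive pinning. [folklore] -/
theorem hostDispersion_pos {ω₂ : ℝ} (hω : 0 < ω₂) (k : ℝ) : 0 < hostDispersion ω₂ k :=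
  Real.sqrt_pos.2 (by linarith [Real.cos_le_one k])

/-- The dispersion relation is positive inside the band away from `k = 0`, for `ω₂ ≥ 0`. [folklore] -/
theorem hostDispersion_pos_of_mem {ω₂ k : ℝ} (hω : 0 ≤ ω₂) (hk : k ∈ hostBand) (hk0 : k ≠ 0) :
    0 < hostDispersion ω₂ k := by
  refine Real.sqrt_pos.2 ?_
  have hc : Real.cos k ≠ 1 := by
    intro h
    have := (Real.cos_eq_one_iff_of_lt_of_lt (by linarith [hk.1, Real.pi_pos])
      (by linarith [hk.2, Real.pi_pos])).1 h
    exact hk0 this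
  have hlt : Real.cos k < 1 := lt_of_le_of_ne (Real.cos_le_one k) hc
  linarith

/-- `ω'(k) = v(k)`: the group velocity is the derivative of the dispersion relation. [folklore] -/
theorem hasDerivAt_hostDispersion {ω₂ : ℝ} (hω : 0 < ω₂) (k : ℝ) :
    HasDerivAt (hostDispersion ω₂) (hostGroupVelocity ω₂ k) k := by
  have h1 : HasDerivAt (fun x => ω₂ + 2 - 2 * Real.cos x) (2 * Real.sin k) k := by
    refine (((Real.hasDerivAt_cos k).const_mul 2).const_sub (ω₂ + 2)).congr_deriv ?_
    ring
  have hne : ω₂ + 2 - 2 * Real.cos k ≠ 0 := ne_of_gt (by linarith [Real.cos_le_one k])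
  have h2 := h1.sqrt hne
  have hfun : hostDispersion ω₂ = fun x => Real.sqrt (ω₂ + 2 - 2 * Real.cos x) := rfl
  rw [hfun]
  refine h2.congr_deriv ?_
  rw [hostGroupVelocity, hostDispersion, mul_div_mul_left _ _ two_ne_zero]

/-- The group velocity is odd: `v(-k) = -v(k)`. [folklore] -/
theorem hostGroupVelocity_neg (ω₂ k : ℝ) : hostGroupVelocity ω₂ (-k) = -hostGroupVelocity ω₂ k := by
  simp [hostGroupVelocity, hostDispersion, Real.sin_neg, Real.cos_neg, neg_div]

/-- `|v(-k)| = |v(k)|`. [folklore] -/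
theorem abs_hostGroupVelocity_neg (ω₂ k : ℝ) :
    |hostGroupVelocity ω₂ (-k)| = |hostGroupVelocity ω₂ k| := by
  rw [hostGroupVelocity_neg, abs_neg]

/-- `sin² k ≤ ω(k)²` for `ω₂ ≥ 0` (since `sin² k = (1 - cos k)(1 + cos k) ≤ 2 - 2 cos k`). [folklore] -/
theorem sin_sq_le_hostDispersion_sq {ω₂ : ℝ} (hω : 0 ≤ ω₂) (k : ℝ) :
    Real.sin k ^ 2 ≤ hostDispersion ω₂ k ^ 2 := by
  rw [hostDispersion_sq hω, Real.sin_sq]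
  nlinarith [Real.cos_le_one k, Real.neg_one_le_cos k]

/-- The group velocity is bounded by `1` (unit harmonic bonds). [folklore] -/
theorem abs_hostGroupVelocity_le_one {ω₂ : ℝ} (hω : 0 ≤ ω₂) (k : ℝ) :
    |hostGroupVelocity ω₂ k| ≤ 1 := by
  unfold hostGroupVelocity
  rcases eq_or_lt_of_le (Real.sqrt_nonneg (ω₂ + 2 - 2 * Real.cos k)) with h | h
  · rw [hostDispersion, ← h, div_zero, abs_zero]; exact zero_le_one
  · have hω' : 0 < hostDispersion ω₂ k := h
    rw [abs_div, abs_of_pos hω', div_le_one hω']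
    exact abs_le_of_sq_le_sq (sin_sq_le_hostDispersion_sq hω k) hω'.le

/-- Right-movers: `v(k) > 0` for `k ∈ (0, π)`. [folklore] -/
theorem hostGroupVelocity_pos {ω₂ k : ℝ} (hω : 0 ≤ ω₂) (hk : k ∈ Ioo 0 Real.pi) :
    0 < hostGroupVelocity ω₂ k := by
  have hkb : k ∈ hostBand := ⟨by linarith [hk.1, Real.pi_pos], hk.2⟩
  exact div_pos (Real.sin_pos_of_pos_of_lt_pi hk.1 hk.2) (hostDispersion_pos_of_mem hω hkb hk.1.ne')

/-- Left-movers: `v(k) < 0` for `k ∈ (-π, 0)`. [folklore] -/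
theorem hostGroupVelocity_neg_of_mem {ω₂ k : ℝ} (hω : 0 ≤ ω₂) (hk : k ∈ Ioo (-Real.pi) 0) :
    hostGroupVelocity ω₂ k < 0 := by
  have h := hostGroupVelocity_pos (ω₂ := ω₂) (k := -k) hω ⟨by linarith [hk.2], by linarith [hk.1]⟩
  rw [hostGroupVelocity_neg] at h
  linarith

/-- The group velocity is measurable. [folklore] -/
@[fun_prop] theorem measurable_hostGroupVelocity (ω₂ : ℝ) : Measurable (hostGroupVelocity ω₂) := by
  unfold hostGroupVelocity hostDispersion
  fun_prop

/-- The group velocity is continuous for positive pinning. [folklore] -/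
theorem continuous_hostGroupVelocity {ω₂ : ℝ} (hω : 0 < ω₂) : Continuous (hostGroupVelocity ω₂) := by
  unfold hostGroupVelocity
  refine Real.continuous_sin.div ?_ fun k => (hostDispersion_pos hω k).ne'
  unfold hostDispersion; fun_prop

/-- The **energy flux functional** (times `2π`): the power carried towards the cell by incident
channels with profile `θ`, or away from it by outgoing ones, `∫ |v(k)| θ(k) dk` (each channel `k`
carries `|v(k)| θ(k) dk / 2π`; Spohn: energy density `ωW`, energy current `(2π)⁻¹ ∫ ∇ω · ωW dk`,
here `θ = ωW` on the band `(-π, π)`). [cite: Spohn2006PhononBoltzmann, §3 (energy current of a space-time stationary state)] -/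
def bandFlux (ω₂ : ℝ) (θ : ℝ → ℝ) : ℝ := ∫ k, |hostGroupVelocity ω₂ k| * θ k ∂hostBandMeasure

/-- The flux functional only depends on the a.e. class of the profile. [folklore] -/
theorem bandFlux_congr_ae {ω₂ : ℝ} {θ θ' : ℝ → ℝ} (h : θ =ᵐ[hostBandMeasure] θ') :
    bandFlux ω₂ θ = bandFlux ω₂ θ' :=
  integral_congr_ae (h.mono fun k hk => by dsimp only; rw [hk])

/-- An `L²` profile is integrable on the (finite) band. [folklore] -/
theorem SpectralProfile.integrable (θ : SpectralProfile) : Integrable (θ : ℝ → ℝ) hostBandMeasure :=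
  (Lp.memLp θ).integrable one_le_two

/-- A bounded measurable weight times an integrable profile is integrable. [folklore] -/
theorem integrable_bdd_mul_of_integrable {w θ : ℝ → ℝ} (hw : Measurable w) {C : ℝ}
    (hC : ∀ k, |w k| ≤ C) (hθ : Integrable θ hostBandMeasure) :
    Integrable (fun k => w k * θ k) hostBandMeasure :=
  hθ.bdd_mul hw.aestronglyMeasurable (ae_of_all _ fun k => by simpa [Real.norm_eq_abs] using hC k)

/-- The flux integrand `|v| θ` is integrable for an `L²` profile (`ω₂ ≥ 0`). [folklore] -/
theorem integrable_abs_hostGroupVelocity_mul {ω₂ : ℝ} (hω : 0 ≤ ω₂) {θ : ℝ → ℝ}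
    (hθ : Integrable θ hostBandMeasure) :
    Integrable (fun k => |hostGroupVelocity ω₂ k| * θ k) hostBandMeasure :=
  integrable_bdd_mul_of_integrable (measurable_hostGroupVelocity ω₂).abs (C := 1)
    (fun k => by simpa [abs_abs] using abs_hostGroupVelocity_le_one hω k) hθ

/-! ## Operators on profiles -/

/-- A measurable function bounded by `C` as an element of `L^∞(band)`. [folklore] -/
def toHostBandLinfty (f : ℝ → ℝ) (hf : Measurable f) (C : ℝ) (hC : ∀ k, |f k| ≤ C) : Lp ℝ ∞ hostBandMeasure :=
  (memLp_top_of_bound hf.aestronglyMeasurable C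
    (ae_of_all _ fun k => by simpa [Real.norm_eq_abs] using hC k)).toLp f

/-- `toHostBandLinfty f` is a.e. `f`. [folklore] -/
theorem coeFn_toHostBandLinfty (f : ℝ → ℝ) (hf : Measurable f) (C : ℝ) (hC : ∀ k, |f k| ≤ C) :
    (toHostBandLinfty f hf C hC : ℝ → ℝ) =ᵐ[hostBandMeasure] f :=
  MemLp.coeFn_toLp _

/-- **Multiplication operator** by `m ∈ L^∞(band)` on profiles (Hölder `∞ · 2 = 2`). [folklore] -/
def spectralMulOp (m : Lp ℝ ∞ hostBandMeasure) : SpectralProfile →L[ℝ] SpectralProfile :=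
  (ContinuousLinearMap.mul ℝ ℝ).holderL hostBandMeasure ∞ 2 2 m

/-- `spectralMulOp m θ = m · θ` a.e. [folklore] -/
theorem coeFn_spectralMulOp (m : Lp ℝ ∞ hostBandMeasure) (θ : SpectralProfile) :
    (spectralMulOp m θ : ℝ → ℝ) =ᵐ[hostBandMeasure] fun k => m k * θ k := by
  have h := (ContinuousLinearMap.mul ℝ ℝ).coeFn_holder (r := 2) m θ
  simpa [spectralMulOp] using h

/-- The indicator of the right-movers `k > 0`, bounded by `1`. [folklore] -/
theorem abs_indicator_Ioi_le_one (k : ℝ) : |(Ioi (0 : ℝ)).indicator (fun _ => (1 : ℝ)) k| ≤ 1 := by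
  by_cases hk : k ∈ Ioi (0 : ℝ) <;> simp [hk]

/-- **Restriction to the right-movers**: `(P₊ θ)(k) = 1_{k > 0} θ(k)`. [folklore] -/
def rightMoverProj : SpectralProfile →L[ℝ] SpectralProfile :=
  spectralMulOp (toHostBandLinfty ((Ioi (0 : ℝ)).indicator fun _ => 1)
    (measurable_const.indicator measurableSet_Ioi) 1 abs_indicator_Ioi_le_one)

/-- `rightMoverProj θ = 1_{(0,∞)} θ` a.e. [folklore] -/
theorem coeFn_rightMoverProj (θ : SpectralProfile) :
    (rightMoverProj θ : ℝ → ℝ) =ᵐ[hostBandMeasure] fun k => (Ioi (0 : ℝ)).indicator (fun _ => (1 : ℝ)) k * θ k := by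
  filter_upwards [coeFn_spectralMulOp _ θ, coeFn_toHostBandLinfty ((Ioi (0 : ℝ)).indicator fun _ => (1 : ℝ))
    (measurable_const.indicator measurableSet_Ioi) 1 abs_indicator_Ioi_le_one] with k hk hk'
  rw [rightMoverProj, hk, hk']

/-- **Reflection** `k ↦ -k` of profiles, `(ρ θ)(k) = θ(-k)` (a linear isometry). [folklore] -/
def spectralReflection : SpectralProfile →L[ℝ] SpectralProfile :=
  (Lp.compMeasurePreservingₗᵢ ℝ (Neg.neg : ℝ → ℝ) measurePreserving_neg_hostBand).toContinuousLinearMap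

/-- `spectralReflection θ = θ ∘ (-·)` a.e. [folklore] -/
theorem coeFn_spectralReflection (θ : SpectralProfile) :
    (spectralReflection θ : ℝ → ℝ) =ᵐ[hostBandMeasure] fun k => θ (-k) :=
  Lp.coeFn_compMeasurePreserving θ measurePreserving_neg_hostBand

/-- `spectralReflection` is an isometry. [folklore] -/
theorem norm_spectralReflection (θ : SpectralProfile) : ‖spectralReflection θ‖ = ‖θ‖ :=
  Lp.norm_compMeasurePreserving θ measurePreserving_neg_hostBand

/-- A profile property holding a.e. holds a.e. after reflection. [folklore] -/
theorem ae_comp_neg {p : ℝ → Prop} (h : ∀ᵐ k ∂hostBandMeasure, p k) : ∀ᵐ k ∂hostBandMeasure, p (-k) :=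
  measurePreserving_neg_hostBand.quasiMeasurePreserving.ae h

/-- Change of variables `k ↦ -k` in band integrals. [folklore] -/
theorem integral_comp_neg_hostBand (g : ℝ → ℝ) : ∫ k, g (-k) ∂hostBandMeasure = ∫ k, g k ∂hostBandMeasure :=
  measurePreserving_neg_hostBand.integral_comp (MeasurableEquiv.neg ℝ).measurableEmbedding g

/-- `rightMoverProj` is positivity preserving. [folklore] -/
theorem rightMoverProj_nonneg {θ : SpectralProfile} (hθ : 0 ≤ θ) : 0 ≤ rightMoverProj θ := by
  have hae : 0 ≤ᵐ[hostBandMeasure] (θ : ℝ → ℝ) := (Lp.coeFn_nonneg θ).mpr hθ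
  refine (Lp.coeFn_nonneg _).mp ?_
  filter_upwards [coeFn_rightMoverProj θ, hae] with k hk h0
  rw [Pi.zero_apply, hk]
  have : 0 ≤ (Ioi (0 : ℝ)).indicator (fun _ => (1 : ℝ)) k := Set.indicator_nonneg (fun _ _ => zero_le_one) k
  exact mul_nonneg this h0

/-- `spectralReflection` is positivity preserving. [folklore] -/
theorem spectralReflection_nonneg {θ : SpectralProfile} (hθ : 0 ≤ θ) : 0 ≤ spectralReflection θ := by
  have hae : 0 ≤ᵐ[hostBandMeasure] (θ : ℝ → ℝ) := (Lp.coeFn_nonneg θ).mpr hθ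
  refine (Lp.coeFn_nonneg _).mp ?_
  filter_upwards [coeFn_spectralReflection θ, ae_comp_neg hae] with k hk h0
  rw [Pi.zero_apply, hk]
  exact h0

/-! ## The interface: scattering data of one cell -/

/-- **Scattering data of one cell in the harmonic host at fixed temperature** (the INTERFACE of the
request `defn-cellTransferOperator`; no existence asserted). `op = 𝕊_T` is the linear response of
the OUTGOING spectral temperature profile to the INCIDENT one (both on the whole band: `k > 0`
incident from the left / outgoing to the right, `k < 0` incident from the right / outgoing to the
left). Axioms: the DECOMPOSITION `(𝕊θ)(k) = |t(k)|² θ(k) + |r(-k)|² θ(-k) + ∫ R(k,k') θ(k') dk'` into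
elastic transmission (same `k`), elastic reflection (`-k ↦ k`) and a nonnegative Hilbert–Schmidt
INELASTIC redistribution kernel, and ENERGY CONSERVATION `∫ |v| 𝕊θ dk = ∫ |v| θ dk` (incident power
`=` outgoing power, to first order). Positivity is a consequence (`op_nonneg`). The request's `𝒦_T`,
`ℛ_T` are the blocks `cellTransferOperator`, `cellReflectionOperator`. Nearest printed instance: the
point Langevin thermostat, `p₊(k)` (transmission), `p₋(k)` (reflection), `g(k)` (absorption),
`p₊ + p₋ + g = 1` (Komorowski–Olla 2020), which has `R = 0` and LOSES the power `∫ |v| g θ`; the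
self-consistent version re-emits it (Bonetto–Lebowitz–Lukkarinen 2004). Komorowski–Olla's interface
condition reads `W(0⁺, k) = p₋(k) W(0⁺, -k) + p₊(k) W(0⁻, k) + 𝔤(k) T` for `k > 0` — the shape of
`op_apply` with the kernel term replaced by emission at the bath temperature. [cite: KomorowskiOlla2020, §1 (interface conditions) and §2.6 (p₊ + p₋ + 𝔤 = 1, W ≡ T stationary)] -/
structure CellScattering (ω₂ : ℝ) where
  /-- `𝕊_T`: incident profile perturbation `↦` outgoing profile perturbation -/
  op : SpectralProfile →L[ℝ] SpectralProfile
  /-- `|t_T(k)|²`: probability that a phonon incident with wavenumber `k` is transmitted elastically -/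
  transProb : ℝ → ℝ
  /-- `|r_T(k)|²`: probability that a phonon incident with wavenumber `k` is reflected elastically (into `-k`) -/
  reflProb : ℝ → ℝ
  /-- `R_T(k, k')`: density (per `dk`) of inelastic redistribution from incident `k'` into outgoing `k` -/
  kernel : ℝ → ℝ → ℝ
  /-- `|t|²` is measurable -/
  measurable_transProb : Measurable transProb
  /-- `|r|²` is measurable -/
  measurable_reflProb : Measurable reflProb
  /-- `R` is jointly measurable -/
  measurable_kernel : Measurable (Function.uncurry kernel)
  /-- `0 ≤ |t|²` -/
  transProb_nonneg : ∀ k, 0 ≤ transProb k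
  /-- `|t|² ≤ 1` -/
  transProb_le_one : ∀ k, transProb k ≤ 1
  /-- `0 ≤ |r|²` -/
  reflProb_nonneg : ∀ k, 0 ≤ reflProb k
  /-- `|r|² ≤ 1` -/
  reflProb_le_one : ∀ k, reflProb k ≤ 1
  /-- the inelastic kernel is nonnegative (positivity of the redistribution) -/
  kernel_nonneg : ∀ k k', 0 ≤ kernel k k'
  /-- the inelastic kernel is Hilbert–Schmidt -/
  kernel_memLp : MemLp (Function.uncurry kernel) 2 (hostBandMeasure.prod hostBandMeasure)
  /-- DECOMPOSITION: elastic transmission + elastic reflection + inelastic kernel -/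
  op_apply : ∀ θ : SpectralProfile, (op θ : ℝ → ℝ) =ᵐ[hostBandMeasure] fun k =>
    transProb k * θ k + reflProb (-k) * θ (-k) + ∫ k', kernel k k' * θ k' ∂hostBandMeasure
  /-- ENERGY CONSERVATION: outgoing power equals incident power -/
  bandFlux_op : ∀ θ : SpectralProfile, bandFlux ω₂ (op θ) = bandFlux ω₂ θ

namespace CellScattering

variable {ω₂ : ℝ} (S : CellScattering ω₂)

/-- The inelastic gain `∫ R(k, k') θ(k') dk'` is nonnegative for `θ ≥ 0` a.e. [folklore] -/
theorem kernel_integral_nonneg {θ : ℝ → ℝ} (hθ : 0 ≤ᵐ[hostBandMeasure] θ) (k : ℝ) :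
    0 ≤ ∫ k', S.kernel k k' * θ k' ∂hostBandMeasure :=
  integral_nonneg_of_ae (hθ.mono fun k' hk' => mul_nonneg (S.kernel_nonneg k k') hk')

/-- **Positivity** of `𝕊_T`: a nonnegative incident perturbation produces a nonnegative outgoing
one (consequence of the decomposition). [folklore] -/
theorem op_nonneg {θ : SpectralProfile} (hθ : 0 ≤ θ) : 0 ≤ S.op θ := by
  have hae : 0 ≤ᵐ[hostBandMeasure] (θ : ℝ → ℝ) := (Lp.coeFn_nonneg θ).mpr hθ
  refine (Lp.coeFn_nonneg _).mp ?_
  filter_upwards [S.op_apply θ, hae, ae_comp_neg hae] with k hk h0 h0'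
  rw [Pi.zero_apply, hk]
  have h1 := S.transProb_nonneg k
  have h2 := S.reflProb_nonneg (-k)
  have h3 := S.kernel_integral_nonneg hae k
  have h0k : 0 ≤ (θ : ℝ → ℝ) k := h0
  have h0k' : 0 ≤ (θ : ℝ → ℝ) (-k) := h0'
  positivity

/-- `𝕊_T` is monotone. [folklore] -/
theorem op_mono {θ θ' : SpectralProfile} (h : θ ≤ θ') : S.op θ ≤ S.op θ' := by
  have := S.op_nonneg (sub_nonneg.2 h)
  rwa [map_sub, sub_nonneg] at this

/-- **Equilibrium is preserved**: the flat incident perturbation (temperature raised by the same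
amount on both sides) produces the flat outgoing one, `𝕊_T 1 = 1`. Not an axiom of the interface
(it expresses that the Gibbs state at `T + ε` is the stationary state with flat incoming data). [folklore] -/
def PreservesFlat {ω₂ : ℝ} (S : CellScattering ω₂) : Prop := S.op flatProfile = flatProfile

end CellScattering

/-- **No cell** (or `lam = β = 0`): every phonon is transmitted, `t ≡ 1`, `r ≡ 0`, `R ≡ 0`, `𝕊 = id`.
Non-vacuity of the interface. [folklore] -/
def CellScattering.transparent (ω₂ : ℝ) : CellScattering ω₂ where
  op := ContinuousLinearMap.id ℝ SpectralProfile
  transProb := fun _ => 1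
  reflProb := fun _ => 0
  kernel := fun _ _ => 0
  measurable_transProb := measurable_const
  measurable_reflProb := measurable_const
  measurable_kernel := measurable_const
  transProb_nonneg := fun _ => zero_le_one
  transProb_le_one := fun _ => le_rfl
  reflProb_nonneg := fun _ => le_rfl
  reflProb_le_one := fun _ => zero_le_one
  kernel_nonneg := fun _ _ => le_rfl
  kernel_memLp := by
    have h : (Function.uncurry fun (_ : ℝ) (_ : ℝ) => (0 : ℝ)) = fun _ => 0 := rfl
    rw [h]
    exact memLp_const 0
  op_apply := fun θ => Eventually.of_forall fun k => by simp
  bandFlux_op := fun _ => rfl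

/-- The interface is inhabited (by the transparent data). [folklore] -/
instance CellScattering.instInhabited (ω₂ : ℝ) : Inhabited (CellScattering ω₂) :=
  ⟨CellScattering.transparent ω₂⟩

/-! ## The request's blocks `𝒦_T`, `ℛ_T` -/

/-- **The cell transfer operator `𝒦_T`** of the request: left-incident perturbation `θ` (supported on
the right-movers `k > 0`) `↦` the right-outgoing perturbation, `𝒦_T = P₊ 𝕊_T P₊` — the bounded linear
map on `L²(band, dk)` such that a left-incoming stationary Gaussian field of profile `T + ε θ` with
thermal right-incoming field produces a right-outgoing profile `T + ε 𝒦_T θ + o(ε)`. [folklore] -/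
def cellTransferOperator {ω₂ : ℝ} (S : CellScattering ω₂) : SpectralProfile →L[ℝ] SpectralProfile :=
  rightMoverProj ∘L S.op ∘L rightMoverProj

/-- **The reflected part `ℛ_T`**: left-incident `θ` `↦` the left-outgoing perturbation read back on
`(0, π)` through `k ↦ -k`, `ℛ_T = P₊ ρ 𝕊_T P₊`. [folklore] -/
def cellReflectionOperator {ω₂ : ℝ} (S : CellScattering ω₂) : SpectralProfile →L[ℝ] SpectralProfile :=
  rightMoverProj ∘L spectralReflection ∘L S.op ∘L rightMoverProj

section Blocks

variable {ω₂ : ℝ} (S : CellScattering ω₂)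

/-- Unfolding `𝒦_T`. [folklore] -/
theorem cellTransferOperator_def (θ : SpectralProfile) :
    cellTransferOperator S θ = rightMoverProj (S.op (rightMoverProj θ)) := rfl

/-- Unfolding `ℛ_T`. [folklore] -/
theorem cellReflectionOperator_def (θ : SpectralProfile) :
    cellReflectionOperator S θ = rightMoverProj (spectralReflection (S.op (rightMoverProj θ))) := rfl

/-- `𝒦_T` is positivity preserving (request: `θ_in ≥ 0 ⇒ 𝒦_T θ_in ≥ 0`). [folklore] -/
theorem cellTransferOperator_nonneg {θ : SpectralProfile} (hθ : 0 ≤ θ) : 0 ≤ cellTransferOperator S θ :=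
  rightMoverProj_nonneg (S.op_nonneg (rightMoverProj_nonneg hθ))

/-- `ℛ_T` is positivity preserving. [folklore] -/
theorem cellReflectionOperator_nonneg {θ : SpectralProfile} (hθ : 0 ≤ θ) : 0 ≤ cellReflectionOperator S θ :=
  rightMoverProj_nonneg (spectralReflection_nonneg (S.op_nonneg (rightMoverProj_nonneg hθ)))

/-- Flux bookkeeping of the two outgoing directions: for every profile `ψ`,
`∫ |v| P₊ψ + ∫ |v| P₊(ρψ) = ∫ |v| ψ` (split the band at `k = 0` and substitute `k ↦ -k` on the
left half; `|v|` is even). [folklore] -/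
theorem bandFlux_rightMoverProj_add_bandFlux_rightMoverProj_reflect (hω : 0 ≤ ω₂) (ψ : SpectralProfile) :
    bandFlux ω₂ (rightMoverProj ψ) + bandFlux ω₂ (rightMoverProj (spectralReflection ψ)) = bandFlux ω₂ ψ := by
  set χ : ℝ → ℝ := (Ioi (0 : ℝ)).indicator fun _ => (1 : ℝ) with hχ
  have hχm : Measurable χ := measurable_const.indicator measurableSet_Ioi
  have hψi : Integrable (ψ : ℝ → ℝ) hostBandMeasure := SpectralProfile.integrable ψ
  have h1 : bandFlux ω₂ (rightMoverProj ψ) =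
      ∫ k, |hostGroupVelocity ω₂ k| * (χ k * ψ k) ∂hostBandMeasure :=
    bandFlux_congr_ae (coeFn_rightMoverProj ψ)
  have h2 : bandFlux ω₂ (rightMoverProj (spectralReflection ψ)) =
      ∫ k, |hostGroupVelocity ω₂ k| * (χ (-k) * ψ k) ∂hostBandMeasure := by
    have hae : (rightMoverProj (spectralReflection ψ) : ℝ → ℝ) =ᵐ[hostBandMeasure] fun k => χ k * ψ (-k) := by
      filter_upwards [coeFn_rightMoverProj (spectralReflection ψ), coeFn_spectralReflection ψ] with k hk hk'
      rw [hk, hk']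
    rw [bandFlux_congr_ae hae, bandFlux]
    have := integral_comp_neg_hostBand fun k => |hostGroupVelocity ω₂ k| * (χ (-k) * ψ k)
    simp only [neg_neg, abs_hostGroupVelocity_neg] at this
    exact this
  have hb : ∀ k, |(|hostGroupVelocity ω₂ k|)| ≤ 1 := fun k => by
    simpa [abs_abs] using abs_hostGroupVelocity_le_one hω k
  have hχb : ∀ k, |χ k| ≤ 1 := abs_indicator_Ioi_le_one
  have hχb' : ∀ k, |χ (-k)| ≤ 1 := fun k => abs_indicator_Ioi_le_one (-k)
  have hi₁ : Integrable (fun k => |hostGroupVelocity ω₂ k| * (χ k * ψ k)) hostBandMeasure :=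
    integrable_bdd_mul_of_integrable (measurable_hostGroupVelocity ω₂).abs hb
      (integrable_bdd_mul_of_integrable hχm hχb hψi)
  have hi₂ : Integrable (fun k => |hostGroupVelocity ω₂ k| * (χ (-k) * ψ k)) hostBandMeasure :=
    integrable_bdd_mul_of_integrable (measurable_hostGroupVelocity ω₂).abs hb
      (integrable_bdd_mul_of_integrable (hχm.comp measurable_neg) hχb' hψi)
  rw [h1, h2, ← integral_add hi₁ hi₂, bandFlux]
  refine integral_congr_ae ?_
  filter_upwards [ae_ne_zero_hostBandMeasure] with k hk
  have hsum : χ k + χ (-k) = 1 := by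
    rcases lt_or_gt_of_ne hk with h | h
    · have h' : ¬ (0 : ℝ) < k := not_lt.2 h.le
      have h'' : (0 : ℝ) < -k := by linarith
      simp [hχ, mem_Ioi, h', h'']
    · have h' : ¬ (0 : ℝ) < -k := by rw [not_lt, neg_nonpos]; exact h.le
      simp [hχ, mem_Ioi, h, h']
  linear_combination (|hostGroupVelocity ω₂ k| * ψ k) * hsum

/-- **Energy conservation in the request's form**: for every incident perturbation `θ`, the power
transmitted to the right plus the power reflected to the left equals the power incident from the
left, `∫_0^π v (𝒦_T θ) dk + ∫_0^π v (ℛ_T θ) dk = ∫_0^π v θ dk` (on `(0, π)`, `|v| = v`), i.e.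
`∫ v [(𝒦_T θ) + (ℛ_T θ) - θ] dk = 0` for `θ` supported on the right-movers. [folklore] -/
theorem bandFlux_cellTransfer_add_cellReflection (hω : 0 ≤ ω₂) (θ : SpectralProfile) :
    bandFlux ω₂ (cellTransferOperator S θ) + bandFlux ω₂ (cellReflectionOperator S θ) =
      bandFlux ω₂ (rightMoverProj θ) := by
  rw [cellTransferOperator_def, cellReflectionOperator_def,
    bandFlux_rightMoverProj_add_bandFlux_rightMoverProj_reflect hω, S.bandFlux_op]

/-- **Decomposition of `𝒦_T`** (request: `𝒦_T =` multiplication by `|t_T(k)|²` `+` Hilbert–Schmidt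
kernel `R_T(k, k') ≥ 0`, both compressed to the right-movers `(0, π)`): the reflection term of `𝕊_T`
does not feed `𝒦_T`. [folklore] -/
theorem cellTransferOperator_apply (θ : SpectralProfile) :
    (cellTransferOperator S θ : ℝ → ℝ) =ᵐ[hostBandMeasure] fun k =>
      (Ioi (0 : ℝ)).indicator (fun _ => (1 : ℝ)) k *
        (S.transProb k * θ k +
          ∫ k', S.kernel k k' * ((Ioi (0 : ℝ)).indicator (fun _ => (1 : ℝ)) k' * θ k') ∂hostBandMeasure) := by
  have hP := coeFn_rightMoverProj θ
  -- the inelastic term only sees the a.e. class of `P₊ θ`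
  have hint : ∀ k, ∫ k', S.kernel k k' * (rightMoverProj θ : ℝ → ℝ) k' ∂hostBandMeasure =
      ∫ k', S.kernel k k' * ((Ioi (0 : ℝ)).indicator (fun _ => (1 : ℝ)) k' * θ k') ∂hostBandMeasure :=
    fun k => integral_congr_ae (hP.mono fun k' hk' => by dsimp only; rw [hk'])
  filter_upwards [coeFn_rightMoverProj (S.op (rightMoverProj θ)), S.op_apply (rightMoverProj θ), hP,
    ae_comp_neg hP] with k hk hop hPk hPk'
  rw [cellTransferOperator_def, hk, hop, hint k, hPk]
  by_cases h0 : (0 : ℝ) < k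
  · have hneg : (rightMoverProj θ : ℝ → ℝ) (-k) = 0 := by
      rw [hPk']
      have : ¬ (0 : ℝ) < -k := by rw [not_lt, neg_nonpos]; exact h0.le
      simp [mem_Ioi, this]
    rw [hneg]
    simp [mem_Ioi, h0]
  · simp [mem_Ioi, h0]

end Blocks

/-! ## Vocabulary for the gap and irreducibility statements -/

/-- **Spectral gap at the flat profile** for a bounded operator `K` on profiles: `K` fixes the flat
profile and contracts STRICTLY the profiles orthogonal to it (`‖K θ‖ ≤ c ‖θ‖`, `c < 1`, for
`⟪1, θ⟫ = 0`). Then `1` is a geometrically simple eigenvalue (`eq_smul_flat_of_fixed`). Stated in the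
unweighted `L²(band, dk)` of the request. [folklore] -/
def HasFlatGap (K : SpectralProfile →L[ℝ] SpectralProfile) : Prop :=
  K flatProfile = flatProfile ∧
    ∃ c : ℝ, c < 1 ∧ ∀ θ : SpectralProfile, ⟪flatProfile, θ⟫_ℝ = 0 → ‖K θ‖ ≤ c * ‖θ‖

/-- Under a flat gap every fixed profile is a multiple of the flat one (simplicity of the
eigenvalue `1`). [folklore] -/
theorem HasFlatGap.eq_smul_flat_of_fixed {K : SpectralProfile →L[ℝ] SpectralProfile} (hK : HasFlatGap K)
    {θ : SpectralProfile} (hθ : K θ = θ) : ∃ a : ℝ, θ = a • flatProfile := by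
  obtain ⟨hflat, c, hc, hgap⟩ := hK
  -- split `θ` along the flat profile
  set a : ℝ := ⟪flatProfile, θ⟫_ℝ / ⟪flatProfile, flatProfile⟫_ℝ with ha
  set η : SpectralProfile := θ - a • flatProfile with hη
  have hff' : ⟪flatProfile, flatProfile⟫_ℝ = 2 * Real.pi := by
    rw [MeasureTheory.L2.inner_def]
    have hae : (fun k => ⟪(flatProfile : ℝ → ℝ) k, (flatProfile : ℝ → ℝ) k⟫_ℝ) =ᵐ[hostBandMeasure]
        fun _ => (1 : ℝ) := by
      filter_upwards [coeFn_flatProfile] with k hk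
      rw [hk]; simp
    rw [integral_congr_ae hae, integral_const, smul_eq_mul, mul_one, Measure.real, hostBandMeasure_univ,
      ENNReal.toReal_ofReal (by positivity)]
  have hff : ⟪flatProfile, flatProfile⟫_ℝ ≠ 0 := by rw [hff']; positivity
  have hηorth : ⟪flatProfile, η⟫_ℝ = 0 := by
    rw [hη, inner_sub_right, real_inner_smul_right, ha, div_mul_cancel₀ _ hff, sub_self]
  have hKη : K η = η := by
    rw [hη, map_sub, map_smul, hflat, hθ]
  have hle : ‖η‖ ≤ c * ‖η‖ := by simpa [hKη] using hgap η hηorth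
  have hη0 : η = 0 := by
    by_contra hne
    have hpos : 0 < ‖η‖ := norm_pos_iff.2 hne
    nlinarith
  refine ⟨a, ?_⟩
  rw [hη, sub_eq_zero] at hη0
  exact hη0

/-- **Irreducibility of a nonnegative kernel on the band**: no measurable `A` of positive but not
full band measure is invariant — some mass is scattered from `A` into its complement, i.e. `R` is
not a.e. zero on `Aᶜ × A`. [folklore] -/
def IsIrreducibleKernel (R : ℝ → ℝ → ℝ) : Prop :=
  ∀ A : Set ℝ, MeasurableSet A → 0 < hostBandMeasure A → 0 < hostBandMeasure Aᶜ →
    0 < ∫⁻ kk in Aᶜ ×ˢ A, ENNReal.ofReal (R kk.1 kk.2) ∂(hostBandMeasure.prod hostBandMeasure)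

/-- **Shape of the Fermi-golden-rule expansion** of the inelastic kernel of a two-parameter family
of scattering data `S lam β` (the conjunct cell with couplings `lam`, `β`): in Hilbert–Schmidt norm,
`R_{lam,β} = lam² R^{(U)} + β² R^{(V)} + lam β R^{(UV)} + O((|lam| + |β|)³)` near `(0, 0)`. The
three kernels are ARGUMENTS (to be supplied / computed by the statement that uses this). [folklore] -/
def HasQuadraticKernelExpansion {ω₂ : ℝ} (S : ℝ → ℝ → CellScattering ω₂)
    (RU RV RUV : ℝ → ℝ → ℝ) : Prop :=
  ∃ C δ : ℝ, 0 < δ ∧ ∀ lam β : ℝ, |lam| < δ → |β| < δ →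
    eLpNorm (fun kk : ℝ × ℝ => (S lam β).kernel kk.1 kk.2 -
        (lam ^ 2 * RU kk.1 kk.2 + β ^ 2 * RV kk.1 kk.2 + lam * β * RUV kk.1 kk.2))
      2 (hostBandMeasure.prod hostBandMeasure) ≤ ENNReal.ofReal (C * (|lam| + |β|) ^ 3)

/-! ## Semantics: spectral covariances, asymptotic profiles, incoming states -/

section Semantics

variable (ω₂ : ℝ)

/-- `⟨p_m p_n⟩` of the translation-invariant free field with spectral temperature profile `ϑ`:
`(2π)⁻¹ ∫ ϑ(k) cos(k(m-n)) dk` (Spohn: the covariances `Q, P, C` of a space-time stationary Gaussian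
state of the harmonic lattice are given by the mode density `W`, `P̂ = ω (W(k) + W(-k))/2`,
`P̂ = ω² Q̂`, `Ĉ` odd; here `ϑ = ωW` per `dk/2π` on `(-π, π)`, and signs / normalisations are fixed
by the single right-moving wave of the module docstring). [cite: Spohn2006PhononBoltzmann, §3 eqs. (3.2)–(3.4)] -/
def profileCovPP (ϑ : ℝ → ℝ) (m n : ℤ) : ℝ :=
  (2 * Real.pi)⁻¹ * ∫ k, ϑ k * Real.cos (k * ((m : ℝ) - n)) ∂hostBandMeasure

/-- `⟨q_m q_n⟩` of the free field with profile `ϑ`: `(2π)⁻¹ ∫ ϑ(k) cos(k(m-n)) / ω(k)² dk`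
(`Q̂ = P̂ / ω²`). [cite: Spohn2006PhononBoltzmann, §3 eqs. (3.2)–(3.4)] -/
def profileCovQQ (ϑ : ℝ → ℝ) (m n : ℤ) : ℝ :=
  (2 * Real.pi)⁻¹ * ∫ k, ϑ k / hostDispersion ω₂ k ^ 2 * Real.cos (k * ((m : ℝ) - n)) ∂hostBandMeasure

/-- `⟨q_m p_n⟩` of the free field with profile `ϑ`: `-(2π)⁻¹ ∫ ϑ(k) sin(k(m-n)) / ω(k) dk` (odd in
`m - n`, vanishing for even `ϑ`; it carries the energy current: with the harmonic bond current
`p_{x+1}(q_x - q_{x+1})`, `⟨j⟩ = ⟨q_x p_{x+1}⟩ = (2π)⁻¹ ∫ v ϑ dk`; for the single right-moving wave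
`cos(kx - ωt)`, `⟨q_x p_0⟩ = -(ω/2) sin(kx)`). [cite: Spohn2006PhononBoltzmann, §3 eqs. (3.2)–(3.4)] -/
def profileCovQP (ϑ : ℝ → ℝ) (m n : ℤ) : ℝ :=
  -((2 * Real.pi)⁻¹ * ∫ k, ϑ k / hostDispersion ω₂ k * Real.sin (k * ((m : ℝ) - n)) ∂hostBandMeasure)

/-- Equipartition check: the flat profile `ϑ ≡ T` has `⟨p_m²⟩ = T`. [folklore] -/
theorem profileCovPP_const_self (T : ℝ) (m : ℤ) : profileCovPP (fun _ => T) m m = T := by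
  simp only [profileCovPP, sub_self, mul_zero, Real.cos_zero, mul_one, integral_const, smul_eq_mul,
    Measure.real, hostBandMeasure_univ]
  rw [ENNReal.toReal_ofReal (by positivity), ← mul_assoc, inv_mul_cancel₀ (by positivity), one_mul]

/-- The flat profile carries no `q`–`p` correlation: `⟨q_m p_n⟩ = 0` for `ϑ ≡ T` (odd integrand on
the symmetric band). [folklore] -/
theorem profileCovQP_const (T : ℝ) (m n : ℤ) : profileCovQP ω₂ (fun _ => T) m n = 0 := by
  have hodd : ∫ k, T / hostDispersion ω₂ k * Real.sin (k * ((m : ℝ) - n)) ∂hostBandMeasure = 0 := by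
    set g : ℝ → ℝ := fun k => T / hostDispersion ω₂ k * Real.sin (k * ((m : ℝ) - n)) with hg
    have h := integral_comp_neg_hostBand g
    have hneg : (fun k => g (-k)) = fun k => -g k := by
      funext k
      simp only [hg, hostDispersion, Real.cos_neg, neg_mul, Real.sin_neg, mul_neg]
    rw [hneg, integral_neg] at h
    change ∫ k, g k ∂hostBandMeasure = 0
    linarith
  simp [profileCovQP, hodd]

/-- `ν` is the (mean-zero) **profile state** with spectral temperature profile `ϑ`: all one-point
means vanish and ALL `q/p` covariances are the spectral covariances of `ϑ` (translation-invariant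
free field; for Gaussian `ν` this determines `ν`). [folklore] -/
def IsProfileState (ν : Measure ChainConfig) (ϑ : ℝ → ℝ) : Prop :=
  (∀ m : ℤ, ∫ σ, (σ m).1 ∂ν = 0 ∧ ∫ σ, (σ m).2 ∂ν = 0) ∧
    ∀ m n : ℤ,
      cov[fun σ => (σ m).1, fun σ => (σ n).1; ν] = profileCovQQ ω₂ ϑ m n ∧
      cov[fun σ => (σ m).2, fun σ => (σ n).2; ν] = profileCovPP ϑ m n ∧
      cov[fun σ => (σ m).1, fun σ => (σ n).2; ν] = profileCovQP ω₂ ϑ m n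

/-- `μ` has **asymptotic profile `ϑ` far to the right**: in windows shifted to `+∞` the means tend to
`0` and the `q/p` covariances tend to the spectral covariances of `ϑ`. On `(0, π)` this is the
right-OUTGOING radiation, on `(-π, 0)` the radiation INCIDENT from the right. [folklore] -/
def HasRightProfile (μ : Measure ChainConfig) (ϑ : ℝ → ℝ) : Prop :=
  (∀ m : ℤ, Tendsto (fun x : ℕ => ∫ σ, (σ ((x : ℤ) + m)).1 ∂μ) atTop (𝓝 0) ∧
      Tendsto (fun x : ℕ => ∫ σ, (σ ((x : ℤ) + m)).2 ∂μ) atTop (𝓝 0)) ∧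
    ∀ m n : ℤ,
      Tendsto (fun x : ℕ => cov[fun σ => (σ ((x : ℤ) + m)).1, fun σ => (σ ((x : ℤ) + n)).1; μ])
        atTop (𝓝 (profileCovQQ ω₂ ϑ m n)) ∧
      Tendsto (fun x : ℕ => cov[fun σ => (σ ((x : ℤ) + m)).2, fun σ => (σ ((x : ℤ) + n)).2; μ])
        atTop (𝓝 (profileCovPP ϑ m n)) ∧
      Tendsto (fun x : ℕ => cov[fun σ => (σ ((x : ℤ) + m)).1, fun σ => (σ ((x : ℤ) + n)).2; μ])
        atTop (𝓝 (profileCovQP ω₂ ϑ m n))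

/-- `μ` has **asymptotic profile `ϑ` far to the left** (windows shifted to `-∞`). On `(0, π)` this is
the radiation INCIDENT from the left, on `(-π, 0)` the left-OUTGOING radiation. [folklore] -/
def HasLeftProfile (μ : Measure ChainConfig) (ϑ : ℝ → ℝ) : Prop :=
  (∀ m : ℤ, Tendsto (fun x : ℕ => ∫ σ, (σ (-(x : ℤ) + m)).1 ∂μ) atTop (𝓝 0) ∧
      Tendsto (fun x : ℕ => ∫ σ, (σ (-(x : ℤ) + m)).2 ∂μ) atTop (𝓝 0)) ∧
    ∀ m n : ℤ,
      Tendsto (fun x : ℕ => cov[fun σ => (σ (-(x : ℤ) + m)).1, fun σ => (σ (-(x : ℤ) + n)).1; μ])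
        atTop (𝓝 (profileCovQQ ω₂ ϑ m n)) ∧
      Tendsto (fun x : ℕ => cov[fun σ => (σ (-(x : ℤ) + m)).2, fun σ => (σ (-(x : ℤ) + n)).2; μ])
        atTop (𝓝 (profileCovPP ϑ m n)) ∧
      Tendsto (fun x : ℕ => cov[fun σ => (σ (-(x : ℤ) + m)).1, fun σ => (σ (-(x : ℤ) + n)).2; μ])
        atTop (𝓝 (profileCovQP ω₂ ϑ m n))

/-- The **outgoing profile** assembled from the two far fields: right-movers far to the right,
left-movers far to the left. [folklore] -/
def outgoingProfile (ϑR ϑL : ℝ → ℝ) : ℝ → ℝ := fun k => if 0 < k then ϑR k else ϑL k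

/-- A state has `L²` coordinates (so that means and covariances are honest). [folklore] -/
def HasL2Coordinates (μ : Measure ChainConfig) : Prop :=
  ∀ x : ℤ, MemLp (fun σ : ChainConfig => (σ x).1) 2 μ ∧ MemLp (fun σ : ChainConfig => (σ x).2) 2 μ

/-- `ν` is the **incoming state** of `μ` under the free dynamics `D₀`: the local weak limit, tested
on bounded smooth local observables, of the FREE evolution of `μ` as `t → +∞`. For a state `μ`
invariant under the interacting flow `Φ` one has `(Φ⁰_t ∘ Φ_{-t})_* μ = (Φ⁰_t)_* μ`, so this is the
law of the incoming (Møller) data without wave operators on paths: what reaches the cell region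
after a long free flight is the radiation that was far away, i.e. not yet scattered. [folklore] -/
def InfiniteChain.Dynamics.IsIncomingStateOf {P₀ : InfiniteChain} (D₀ : P₀.Dynamics)
    (μ ν : Measure ChainConfig) : Prop :=
  ∀ (Λ : Finset ℤ) (F : ChainConfig → ℝ), IsSmoothLocalObservable Λ F → (∃ C : ℝ, ∀ σ, |F σ| ≤ C) →
    Tendsto (fun t : ℝ => ∫ σ, F (D₀.flow t σ) ∂μ) atTop (𝓝 (∫ σ, F σ ∂ν))

/-- `ν` is the **outgoing state** of `μ` under `D₀`: the local weak limit of the free evolution as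
`t → -∞`. [folklore] -/
def InfiniteChain.Dynamics.IsOutgoingStateOf {P₀ : InfiniteChain} (D₀ : P₀.Dynamics)
    (μ ν : Measure ChainConfig) : Prop :=
  ∀ (Λ : Finset ℤ) (F : ChainConfig → ℝ), IsSmoothLocalObservable Λ F → (∃ C : ℝ, ∀ σ, |F σ| ≤ C) →
    Tendsto (fun t : ℝ => ∫ σ, F (D₀.flow t σ) ∂μ) atBot (𝓝 (∫ σ, F σ ∂ν))

/-- A **Gaussian-driven stationary state** of the cell dynamics `D` at base temperature `T`, driving
amplitude `ε` and incident perturbation profile `θ`: a `D`-invariant probability measure with `L²`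
coordinates whose incoming state (w.r.t. the free host dynamics `D₀`) is the GAUSSIAN profile state
of profile `T + ε θ`. [folklore] -/
def IsDrivenState {P₀ P : InfiniteChain} (D₀ : P₀.Dynamics) (D : P.Dynamics) (T ε : ℝ)
    (θ : ℝ → ℝ) (μ : Measure ChainConfig) : Prop :=
  IsProbabilityMeasure μ ∧ D.PreservesMeasure μ ∧ HasL2Coordinates μ ∧
    ∃ ν : Measure ChainConfig, D₀.IsIncomingStateOf μ ν ∧ IsGaussian ν ∧
      IsProfileState ω₂ ν fun k => T + ε * θ k

/-- **`S` is the cell scattering data at temperature `T`** of the cell dynamics `D` relative to the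
free host dynamics `D₀` (intended: `P₀ = harmonicHostWithCell ω₂ lam β ∅`,
`P = harmonicHostWithCell ω₂ lam β {0}`): for every BOUNDED incident perturbation `θ` there is an
error `r(ε) = o(ε)` such that every Gaussian-driven stationary state at amplitude `ε` has far-right
and far-left profiles whose outgoing parts equal `T + ε 𝕊_T θ` up to `r(ε)` in `L²(band)`. Linear
response to Gaussian inputs is the DEFINITION of `𝕊_T` (and of `𝒦_T = cellTransferOperator S`);
vacuous unless such states exist (`HasGaussianScatteringStates`). [folklore] -/
def IsCellScatteringOf {ω₂ : ℝ} {P₀ P : InfiniteChain} (D₀ : P₀.Dynamics) (D : P.Dynamics)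
    (T : ℝ) (S : CellScattering ω₂) : Prop :=
  ∀ θ : SpectralProfile, (∃ C : ℝ, ∀ᵐ k ∂hostBandMeasure, |θ k| ≤ C) →
    ∃ r : ℝ → ℝ, Tendsto (fun ε => r ε / ε) (𝓝[≠] 0) (𝓝 0) ∧
      ∀ (ε : ℝ) (μ : Measure ChainConfig), IsDrivenState ω₂ D₀ D T ε θ μ →
        ∃ ϑR ϑL : ℝ → ℝ, HasRightProfile ω₂ μ ϑR ∧ HasLeftProfile ω₂ μ ϑL ∧
          MemLp (outgoingProfile ϑR ϑL) 2 hostBandMeasure ∧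
          eLpNorm (fun k => outgoingProfile ϑR ϑL k - (T + ε * (S.op θ : ℝ → ℝ) k)) 2 hostBandMeasure ≤
            ENNReal.ofReal (r ε)

/-- **CONSTRUCTION statement (shape)**: for every bounded incident perturbation `θ` and all small
`ε`, the Gaussian-driven stationary state exists and is unique — the cell driven by stationary
Gaussian inputs has a unique stationary state (to be proved from `HarmonicHostWithCell` / the
generalized Langevin representation; the support item announced in the request). [folklore] -/
def HasGaussianScatteringStates {P₀ P : InfiniteChain} (D₀ : P₀.Dynamics) (D : P.Dynamics)
    (T : ℝ) : Prop :=
  ∀ θ : SpectralProfile, (∃ C : ℝ, ∀ᵐ k ∂hostBandMeasure, |θ k| ≤ C) →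
    ∃ ε₀ : ℝ, 0 < ε₀ ∧ ∀ ε : ℝ, |ε| < ε₀ →
      ∃! μ : Measure ChainConfig, IsDrivenState ω₂ D₀ D T ε θ μ

end Semantics


/-! ## Example: the self-consistent point scatterer (Büttiker probe / self-consistent reservoir) -/

section Probe

/-- Data of a **point scatterer**: elastic transmission and reflection probabilities `τ, ρ` and an
absorption probability `g` for a phonon incident with wavenumber `k`, `τ + ρ + g = 1`, with `ρ`
even (Komorowski–Olla's `p₊, p₋, 𝔤`, all even there). [cite: KomorowskiOlla2020, §2.6 (p₊ + p₋ + 𝔤 = 1)] -/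
structure ProbeData where
  /-- elastic transmission probability -/
  τ : ℝ → ℝ
  /-- elastic reflection probability -/
  ρ : ℝ → ℝ
  /-- absorption probability -/
  g : ℝ → ℝ
  /-- `τ` is measurable -/
  measurable_τ : Measurable τ
  /-- `ρ` is measurable -/
  measurable_ρ : Measurable ρ
  /-- `g` is measurable -/
  measurable_g : Measurable g
  /-- `0 ≤ τ` -/
  τ_nonneg : ∀ k, 0 ≤ τ k
  /-- `0 ≤ ρ` -/
  ρ_nonneg : ∀ k, 0 ≤ ρ k
  /-- `0 ≤ g` -/
  g_nonneg : ∀ k, 0 ≤ g k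
  /-- normalisation: an incident phonon is transmitted, reflected or absorbed -/
  sum_eq_one : ∀ k, τ k + ρ k + g k = 1
  /-- the reflection probability is even in `k` -/
  ρ_even : ∀ k, ρ (-k) = ρ k

namespace ProbeData

variable (d : ProbeData)

/-- `τ ≤ 1`. [folklore] -/
theorem τ_le_one (k : ℝ) : d.τ k ≤ 1 := by linarith [d.sum_eq_one k, d.ρ_nonneg k, d.g_nonneg k]

/-- `ρ ≤ 1`. [folklore] -/
theorem ρ_le_one (k : ℝ) : d.ρ k ≤ 1 := by linarith [d.sum_eq_one k, d.τ_nonneg k, d.g_nonneg k]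

/-- `g ≤ 1`. [folklore] -/
theorem g_le_one (k : ℝ) : d.g k ≤ 1 := by linarith [d.sum_eq_one k, d.τ_nonneg k, d.ρ_nonneg k]

/-- `|τ| ≤ 1`. [folklore] -/
theorem abs_τ_le_one (k : ℝ) : |d.τ k| ≤ 1 := abs_le.2 ⟨by linarith [d.τ_nonneg k], d.τ_le_one k⟩

/-- `|ρ(-k)| ≤ 1`. [folklore] -/
theorem abs_ρ_neg_le_one (k : ℝ) : |d.ρ (-k)| ≤ 1 :=
  abs_le.2 ⟨by linarith [d.ρ_nonneg (-k)], d.ρ_le_one (-k)⟩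

/-- `|g| ≤ 1`. [folklore] -/
theorem abs_g_le_one (k : ℝ) : |d.g k| ≤ 1 := abs_le.2 ⟨by linarith [d.g_nonneg k], d.g_le_one k⟩

/-- `k ↦ ρ(-k)` is measurable. [folklore] -/
theorem measurable_ρ_neg : Measurable fun k => d.ρ (-k) := d.measurable_ρ.comp measurable_neg

/-- `τ` as an element of `L^∞(band)`. [folklore] -/
def τLinfty : Lp ℝ ∞ hostBandMeasure := toHostBandLinfty d.τ d.measurable_τ 1 d.abs_τ_le_one

/-- `ρ(-·)` as an element of `L^∞(band)`. [folklore] -/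
def ρNegLinfty : Lp ℝ ∞ hostBandMeasure :=
  toHostBandLinfty (fun k => d.ρ (-k)) d.measurable_ρ_neg 1 d.abs_ρ_neg_le_one

/-- `τLinfty = τ` a.e. [folklore] -/
theorem coeFn_τLinfty : (d.τLinfty : ℝ → ℝ) =ᵐ[hostBandMeasure] d.τ := coeFn_toHostBandLinfty _ _ _ _

/-- `ρNegLinfty = ρ(-·)` a.e. [folklore] -/
theorem coeFn_ρNegLinfty : (d.ρNegLinfty : ℝ → ℝ) =ᵐ[hostBandMeasure] fun k => d.ρ (-k) :=
  coeFn_toHostBandLinfty _ _ _ _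

/-- A measurable function bounded by `1` is in `L²(band)`. [folklore] -/
theorem memLp_two_of_abs_le_one {f : ℝ → ℝ} (hf : Measurable f) (h1 : ∀ k, |f k| ≤ 1) :
    MemLp f 2 hostBandMeasure :=
  (memLp_top_of_bound hf.aestronglyMeasurable 1
    (ae_of_all _ fun k => by simpa [Real.norm_eq_abs] using h1 k)).mono_exponent le_top

/-- `g` is integrable on the band. [folklore] -/
theorem integrable_g : Integrable d.g hostBandMeasure :=
  (memLp_two_of_abs_le_one d.measurable_g d.abs_g_le_one).integrable one_le_two

variable (ω₂ : ℝ)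

/-- The absorption weight `w(k) = |v(k)| g(k)` (absorbed power per unit incident profile). [folklore] -/
def weight (k : ℝ) : ℝ := |hostGroupVelocity ω₂ k| * d.g k

/-- The weight is measurable. [folklore] -/
theorem measurable_weight : Measurable (d.weight ω₂) :=
  (measurable_hostGroupVelocity ω₂).abs.mul d.measurable_g

/-- The weight is nonnegative. [folklore] -/
theorem weight_nonneg (k : ℝ) : 0 ≤ d.weight ω₂ k := mul_nonneg (abs_nonneg _) (d.g_nonneg k)

/-- `|w| ≤ 1` for `ω₂ ≥ 0`. [folklore] -/
theorem abs_weight_le_one {ω₂ : ℝ} (hω : 0 ≤ ω₂) (k : ℝ) : |d.weight ω₂ k| ≤ 1 := by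
  rw [weight, abs_mul, abs_abs]
  have h1 := abs_hostGroupVelocity_le_one hω k
  have h2 := d.abs_g_le_one k
  have := abs_nonneg (hostGroupVelocity ω₂ k)
  have := abs_nonneg (d.g k)
  nlinarith

/-- The weight is integrable (`ω₂ ≥ 0`). [folklore] -/
theorem integrable_weight {ω₂ : ℝ} (hω : 0 ≤ ω₂) : Integrable (d.weight ω₂) hostBandMeasure :=
  integrable_abs_hostGroupVelocity_mul hω d.integrable_g

/-- The total absorbed power per unit flat profile, `Z = ∫ |v| g dk`. [folklore] -/
def absorbedPower : ℝ := ∫ k, d.weight ω₂ k ∂hostBandMeasure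

/-- The weight as an element of `L²(band)`. [folklore] -/
def weightL2 {ω₂ : ℝ} (hω : 0 ≤ ω₂) : SpectralProfile :=
  (memLp_two_of_abs_le_one (d.measurable_weight ω₂) (d.abs_weight_le_one hω)).toLp _

/-- The absorption probability as an element of `L²(band)` (the emission profile). [folklore] -/
def gL2 : SpectralProfile :=
  (memLp_two_of_abs_le_one d.measurable_g d.abs_g_le_one).toLp _

/-- `weightL2 = w` a.e. [folklore] -/
theorem coeFn_weightL2 {ω₂ : ℝ} (hω : 0 ≤ ω₂) :
    (d.weightL2 hω : ℝ → ℝ) =ᵐ[hostBandMeasure] d.weight ω₂ := MemLp.coeFn_toLp _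

/-- `gL2 = g` a.e. [folklore] -/
theorem coeFn_gL2 : (d.gL2 : ℝ → ℝ) =ᵐ[hostBandMeasure] d.g := MemLp.coeFn_toLp _

/-- `⟪w, θ⟫ = ∫ w θ dk`: the power absorbed from the incident perturbation `θ`. [folklore] -/
theorem inner_weightL2 {ω₂ : ℝ} (hω : 0 ≤ ω₂) (θ : SpectralProfile) :
    ⟪d.weightL2 hω, θ⟫_ℝ = ∫ k, d.weight ω₂ k * θ k ∂hostBandMeasure := by
  rw [MeasureTheory.L2.inner_def]
  refine integral_congr_ae ?_
  filter_upwards [d.coeFn_weightL2 hω] with k hk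
  rw [hk]
  simp [mul_comm]

/-- The elastic part `θ ↦ τ θ + ρ(-·) θ(-·)`. [folklore] -/
def elasticOp : SpectralProfile →L[ℝ] SpectralProfile :=
  spectralMulOp d.τLinfty + (spectralMulOp d.ρNegLinfty) ∘L spectralReflection

/-- The absorption–re-emission part `θ ↦ Z⁻¹ ⟪w, θ⟫ g` (rank one). [folklore] -/
def emissionOp {ω₂ : ℝ} (hω : 0 ≤ ω₂) : SpectralProfile →L[ℝ] SpectralProfile :=
  (d.absorbedPower ω₂)⁻¹ • (innerSL ℝ (d.weightL2 hω)).smulRight d.gL2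

/-- **The self-consistent point scatterer as an operator**:
`(𝕊θ)(k) = τ(k) θ(k) + ρ(-k) θ(-k) + g(k) Z⁻¹ ∫ |v| g θ dk'` — elastic transmission and reflection,
absorption of the power `∫ |v| g θ`, and its re-emission with the emission profile `g` at the
self-consistent temperature shift `Z⁻¹ ∫ |v| g θ` (the Büttiker probe / self-consistent reservoir:
the probe temperature is fixed by zero net energy exchange). [folklore] -/
def op {ω₂ : ℝ} (hω : 0 ≤ ω₂) : SpectralProfile →L[ℝ] SpectralProfile :=
  d.elasticOp + d.emissionOp hω

/-- The re-emission kernel `R(k, k') = g(k) |v(k')| g(k') / Z` (rank one, nonnegative). [folklore] -/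
def kernel (k k' : ℝ) : ℝ := d.g k * d.weight ω₂ k' / d.absorbedPower ω₂

/-- Pointwise formula for the elastic part. [folklore] -/
theorem coeFn_elasticOp (θ : SpectralProfile) :
    (d.elasticOp θ : ℝ → ℝ) =ᵐ[hostBandMeasure] fun k => d.τ k * θ k + d.ρ (-k) * θ (-k) := by
  have e : d.elasticOp θ =
      spectralMulOp d.τLinfty θ + spectralMulOp d.ρNegLinfty (spectralReflection θ) := rfl
  rw [e]
  filter_upwards [Lp.coeFn_add (spectralMulOp d.τLinfty θ)
      (spectralMulOp d.ρNegLinfty (spectralReflection θ)),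
    coeFn_spectralMulOp d.τLinfty θ, d.coeFn_τLinfty,
    coeFn_spectralMulOp d.ρNegLinfty (spectralReflection θ), d.coeFn_ρNegLinfty,
    coeFn_spectralReflection θ] with k hk h1 h1' h2 h2' h3
  rw [hk, Pi.add_apply, h1, h1', h2, h2', h3]

/-- Pointwise formula for the re-emission part. [folklore] -/
theorem coeFn_emissionOp {ω₂ : ℝ} (hω : 0 ≤ ω₂) (θ : SpectralProfile) :
    (d.emissionOp hω θ : ℝ → ℝ) =ᵐ[hostBandMeasure] fun k =>
      (d.absorbedPower ω₂)⁻¹ * (∫ k', d.weight ω₂ k' * θ k' ∂hostBandMeasure) * d.g k := by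
  have e : d.emissionOp hω θ =
      ((d.absorbedPower ω₂)⁻¹ * ∫ k', d.weight ω₂ k' * θ k' ∂hostBandMeasure) • d.gL2 := by
    rw [← d.inner_weightL2 hω θ, ← smul_smul]; rfl
  rw [e]
  filter_upwards [Lp.coeFn_smul ((d.absorbedPower ω₂)⁻¹ *
    ∫ k', d.weight ω₂ k' * θ k' ∂hostBandMeasure) d.gL2, d.coeFn_gL2] with k hk hk'
  rw [hk, Pi.smul_apply, hk', smul_eq_mul]

/-- Pointwise formula for the probe operator. [folklore] -/
theorem coeFn_op {ω₂ : ℝ} (hω : 0 ≤ ω₂) (θ : SpectralProfile) :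
    (d.op hω θ : ℝ → ℝ) =ᵐ[hostBandMeasure] fun k =>
      d.τ k * θ k + d.ρ (-k) * θ (-k) +
        (d.absorbedPower ω₂)⁻¹ * (∫ k', d.weight ω₂ k' * θ k' ∂hostBandMeasure) * d.g k := by
  have e : d.op hω θ = d.elasticOp θ + d.emissionOp hω θ := rfl
  rw [e]
  filter_upwards [Lp.coeFn_add (d.elasticOp θ) (d.emissionOp hω θ), d.coeFn_elasticOp θ,
    d.coeFn_emissionOp hω θ] with k hk h1 h2
  rw [hk, Pi.add_apply, h1, h2]

/-- The kernel form of the re-emission term. [folklore] -/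
theorem integral_kernel_mul (θ : ℝ → ℝ) (k : ℝ) :
    ∫ k', d.kernel ω₂ k k' * θ k' ∂hostBandMeasure =
      (d.absorbedPower ω₂)⁻¹ * (∫ k', d.weight ω₂ k' * θ k' ∂hostBandMeasure) * d.g k := by
  have : (fun k' => d.kernel ω₂ k k' * θ k') =
      fun k' => (d.absorbedPower ω₂)⁻¹ * d.g k * (d.weight ω₂ k' * θ k') := by
    funext k'; simp only [kernel]; ring
  rw [this, integral_const_mul]
  ring

/-- If no power is absorbed (`Z = 0`) the weight vanishes a.e. [folklore] -/
theorem weight_ae_eq_zero_of_absorbedPower_eq_zero {ω₂ : ℝ} (hω : 0 ≤ ω₂)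
    (hZ : d.absorbedPower ω₂ = 0) : d.weight ω₂ =ᵐ[hostBandMeasure] 0 :=
  (integral_eq_zero_iff_of_nonneg (fun k => d.weight_nonneg ω₂ k) (d.integrable_weight hω)).1 hZ

/-- The re-emitted power equals the absorbed power: `Z⁻¹ (∫ w θ) Z = ∫ w θ` (also when `Z = 0`,
both sides vanishing). [folklore] -/
theorem reemitted_power {ω₂ : ℝ} (hω : 0 ≤ ω₂) (θ : ℝ → ℝ) :
    (d.absorbedPower ω₂)⁻¹ * (∫ k', d.weight ω₂ k' * θ k' ∂hostBandMeasure) * d.absorbedPower ω₂ =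
      ∫ k', d.weight ω₂ k' * θ k' ∂hostBandMeasure := by
  by_cases hZ : d.absorbedPower ω₂ = 0
  · have h0 := d.weight_ae_eq_zero_of_absorbedPower_eq_zero hω hZ
    have hI : ∫ k', d.weight ω₂ k' * θ k' ∂hostBandMeasure = 0 :=
      integral_eq_zero_of_ae (h0.mono fun k hk => by dsimp only; rw [hk, Pi.zero_apply, zero_mul])
    rw [hI, hZ]; ring
  · field_simp

/-- **Energy conservation of the self-consistent scatterer**: what is absorbed is re-emitted. [folklore] -/
theorem bandFlux_op {ω₂ : ℝ} (hω : 0 ≤ ω₂) (θ : SpectralProfile) :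
    bandFlux ω₂ (d.op hω θ) = bandFlux ω₂ θ := by
  set I : ℝ := ∫ k', d.weight ω₂ k' * θ k' ∂hostBandMeasure with hI
  have hθi : Integrable (θ : ℝ → ℝ) hostBandMeasure := SpectralProfile.integrable θ
  have hθi' : Integrable (fun k => (θ : ℝ → ℝ) (-k)) hostBandMeasure :=
    (measurePreserving_neg_hostBand.integrable_comp hθi.aestronglyMeasurable).2 hθi
  have hb : ∀ k, |(|hostGroupVelocity ω₂ k|)| ≤ 1 := fun k => by
    simpa [abs_abs] using abs_hostGroupVelocity_le_one hω k
  have hvm : Measurable fun k => |hostGroupVelocity ω₂ k| := (measurable_hostGroupVelocity ω₂).abs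
  have i1 : Integrable (fun k => |hostGroupVelocity ω₂ k| * (d.τ k * θ k)) hostBandMeasure :=
    integrable_bdd_mul_of_integrable hvm hb (integrable_bdd_mul_of_integrable d.measurable_τ
      d.abs_τ_le_one hθi)
  have i2 : Integrable (fun k => |hostGroupVelocity ω₂ k| * (d.ρ (-k) * θ (-k))) hostBandMeasure :=
    integrable_bdd_mul_of_integrable hvm hb (integrable_bdd_mul_of_integrable d.measurable_ρ_neg
      d.abs_ρ_neg_le_one hθi')
  have i3 : Integrable (fun k => (d.absorbedPower ω₂)⁻¹ * I * d.weight ω₂ k) hostBandMeasure :=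
    (d.integrable_weight hω).const_mul _
  have i4 : Integrable (fun k => |hostGroupVelocity ω₂ k| * (d.ρ k * θ k)) hostBandMeasure :=
    integrable_bdd_mul_of_integrable hvm hb (integrable_bdd_mul_of_integrable d.measurable_ρ
      (fun k => abs_le.2 ⟨by linarith [d.ρ_nonneg k], d.ρ_le_one k⟩) hθi)
  have i5 : Integrable (fun k => d.weight ω₂ k * θ k) hostBandMeasure :=
    integrable_bdd_mul_of_integrable (d.measurable_weight ω₂) (d.abs_weight_le_one hω) hθi
  -- the reflected power, by `k ↦ -k`
  have hB : ∫ k, |hostGroupVelocity ω₂ k| * (d.ρ (-k) * θ (-k)) ∂hostBandMeasure =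
      ∫ k, |hostGroupVelocity ω₂ k| * (d.ρ k * θ k) ∂hostBandMeasure := by
    have := integral_comp_neg_hostBand fun k => |hostGroupVelocity ω₂ k| * (d.ρ k * θ k)
    simp only [abs_hostGroupVelocity_neg] at this
    exact this
  rw [bandFlux_congr_ae (d.coeFn_op hω θ), bandFlux, bandFlux]
  have hsplit : (fun k => |hostGroupVelocity ω₂ k| * (d.τ k * θ k + d.ρ (-k) * θ (-k) +
      (d.absorbedPower ω₂)⁻¹ * I * d.g k)) = fun k =>
      (|hostGroupVelocity ω₂ k| * (d.τ k * θ k) + |hostGroupVelocity ω₂ k| * (d.ρ (-k) * θ (-k))) +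
        (d.absorbedPower ω₂)⁻¹ * I * d.weight ω₂ k := by
    funext k; simp only [weight]; ring
  have i12 : Integrable (fun k => |hostGroupVelocity ω₂ k| * (d.τ k * θ k) +
      |hostGroupVelocity ω₂ k| * (d.ρ (-k) * θ (-k))) hostBandMeasure := i1.add i2
  have i14 : Integrable (fun k => |hostGroupVelocity ω₂ k| * (d.τ k * θ k) +
      |hostGroupVelocity ω₂ k| * (d.ρ k * θ k)) hostBandMeasure := i1.add i4
  rw [hsplit, integral_add i12 i3, integral_add i1 i2, integral_const_mul, hB]
  have hZ : ∫ k, d.weight ω₂ k ∂hostBandMeasure = d.absorbedPower ω₂ := rfl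
  rw [hZ, hI, d.reemitted_power hω]
  have hrhs : (fun k => |hostGroupVelocity ω₂ k| * (θ : ℝ → ℝ) k) = fun k =>
      (|hostGroupVelocity ω₂ k| * (d.τ k * θ k) + |hostGroupVelocity ω₂ k| * (d.ρ k * θ k)) +
        d.weight ω₂ k * θ k := by
    funext k
    have hs := d.sum_eq_one k
    simp only [weight]
    linear_combination (-(|hostGroupVelocity ω₂ k| * θ k)) * hs
  rw [hrhs, integral_add i14 i5, integral_add i1 i4]

end ProbeData

/-- **The self-consistent point scatterer realises the interface** with a nonzero inelastic
kernel: `𝕊θ = τ θ + ρ(-·) θ(-·) + g Z⁻¹ ∫ |v| g θ`, `R(k, k') = g(k) |v(k')| g(k') / Z ≥ 0`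
(rank one), energy conserving (Büttiker 1986 voltage/temperature probe; Bonetto–Lebowitz–Lukkarinen
2004 self-consistent reservoirs, here resolved in wavenumber with Komorowski–Olla's coefficients). [folklore] -/
def CellScattering.probe {ω₂ : ℝ} (hω : 0 ≤ ω₂) (d : ProbeData) : CellScattering ω₂ where
  op := d.op hω
  transProb := d.τ
  reflProb := d.ρ
  kernel := d.kernel ω₂
  measurable_transProb := d.measurable_τ
  measurable_reflProb := d.measurable_ρ
  measurable_kernel := by
    change Measurable fun kk : ℝ × ℝ => d.g kk.1 * d.weight ω₂ kk.2 / d.absorbedPower ω₂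
    exact ((d.measurable_g.comp measurable_fst).mul
      ((d.measurable_weight ω₂).comp measurable_snd)).div_const _
  transProb_nonneg := d.τ_nonneg
  transProb_le_one := d.τ_le_one
  reflProb_nonneg := d.ρ_nonneg
  reflProb_le_one := d.ρ_le_one
  kernel_nonneg := fun k k' => by
    unfold ProbeData.kernel ProbeData.absorbedPower
    exact div_nonneg (mul_nonneg (d.g_nonneg k) (d.weight_nonneg ω₂ k'))
      (integral_nonneg fun k => d.weight_nonneg ω₂ k)
  kernel_memLp := by
    have hm : Measurable (Function.uncurry (d.kernel ω₂)) := by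
      change Measurable fun kk : ℝ × ℝ => d.g kk.1 * d.weight ω₂ kk.2 / d.absorbedPower ω₂
      exact ((d.measurable_g.comp measurable_fst).mul
        ((d.measurable_weight ω₂).comp measurable_snd)).div_const _
    refine (memLp_top_of_bound hm.aestronglyMeasurable |(d.absorbedPower ω₂)⁻¹|
      (ae_of_all _ fun kk => ?_)).mono_exponent le_top
    rw [Real.norm_eq_abs]
    change |d.g kk.1 * d.weight ω₂ kk.2 / d.absorbedPower ω₂| ≤ |(d.absorbedPower ω₂)⁻¹|
    rw [div_eq_mul_inv, abs_mul, abs_mul]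
    have h1 := d.abs_g_le_one kk.1
    have h2 := d.abs_weight_le_one hω kk.2
    have h3 := abs_nonneg (d.absorbedPower ω₂)⁻¹
    have h4 := abs_nonneg (d.weight ω₂ kk.2)
    calc |d.g kk.1| * |d.weight ω₂ kk.2| * |(d.absorbedPower ω₂)⁻¹|
        ≤ 1 * 1 * |(d.absorbedPower ω₂)⁻¹| := by gcongr
      _ = |(d.absorbedPower ω₂)⁻¹| := by ring
  op_apply := fun θ => by
    filter_upwards [d.coeFn_op hω θ] with k hk
    rw [hk, d.integral_kernel_mul ω₂ (θ : ℝ → ℝ) k]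
  bandFlux_op := d.bandFlux_op hω

/-- **The self-consistent scatterer preserves the flat profile** (`𝕊 1 = 1`: a probe in an
equilibrium environment settles at the environment's temperature). [folklore] -/
theorem CellScattering.probe_preservesFlat {ω₂ : ℝ} (hω : 0 ≤ ω₂) (d : ProbeData) :
    (CellScattering.probe hω d).PreservesFlat := by
  have hI : ∫ k', d.weight ω₂ k' * (flatProfile : ℝ → ℝ) k' ∂hostBandMeasure = d.absorbedPower ω₂ :=
    integral_congr_ae (coeFn_flatProfile.mono fun k hk => by dsimp only; rw [hk, mul_one])
  -- a.e. `Z⁻¹ Z g = g` (trivial if `Z ≠ 0`; if `Z = 0` then `|v| g = 0` a.e., so `g = 0` a.e.)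
  have hg : ∀ᵐ k ∂hostBandMeasure,
      (d.absorbedPower ω₂)⁻¹ * d.absorbedPower ω₂ * d.g k = d.g k := by
    by_cases hZ : d.absorbedPower ω₂ = 0
    · filter_upwards [d.weight_ae_eq_zero_of_absorbedPower_eq_zero hω hZ, ae_mem_hostBand,
        ae_ne_zero_hostBandMeasure] with k hk hkb hk0
      have hv : hostGroupVelocity ω₂ k ≠ 0 := by
        rcases lt_or_gt_of_ne hk0 with h | h
        · exact (hostGroupVelocity_neg_of_mem hω ⟨hkb.1, h⟩).ne
        · exact (hostGroupVelocity_pos hω ⟨h, hkb.2⟩).ne'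
      have hw : |hostGroupVelocity ω₂ k| * d.g k = 0 := hk
      have hg0 : d.g k = 0 := by
        rcases mul_eq_zero.1 hw with h | h
        · exact absurd (abs_eq_zero.1 h) hv
        · exact h
      simp [hg0]
    · filter_upwards with k
      rw [inv_mul_cancel₀ hZ, one_mul]
  refine Lp.ext ?_
  filter_upwards [d.coeFn_op hω flatProfile, coeFn_flatProfile, ae_comp_neg coeFn_flatProfile, hg]
    with k hk h1 h1' hgk
  change (d.op hω flatProfile : ℝ → ℝ) k = (flatProfile : ℝ → ℝ) k
  rw [hk, hI, h1, hgk]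
  have h1'' : (flatProfile : ℝ → ℝ) (-k) = 1 := h1'
  rw [h1'', mul_one, mul_one, d.ρ_even k]
  exact d.sum_eq_one k

end Probe

end Literature.MathematicalPhysics.KineticTheory.HeatConduction

end
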